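import Summits.Ventures.Crystal3D.Bulk.SphPolygonFan
import HarnessLib

/-!
# Locating two points of a convex polygonal cone on a supporting great circle — brick (S6) of
# (d3) «one rattler per p-hexagon»

HONEST FRAMING. Part of the venture `Summits/Ventures/Crystal3D` (cell `pub-crystal3d`, phase 2;
seat typer-bulk-2), generic and configuration-free; nothing here mentions GAP(1.26). Setting of
`Bulk/SphPolygonFan.lean`: a periodic window-convex polygon `v` (period `m ≥ 3`) all of whose
vertices lie on the closed positive side of a great circle `ν⊥`. In the perimeter proof of the
census row (d3) (`phase2/theory1/HEX-PERIMETER.md`, plan `HOME/lean/hexper/README.md` S6) this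
is the situation after clipping the face along a common tangent of the two rattler caps: the two
tangent points lie on the new side.

* `two_zeros_adjacent` — two vertices on the circle with indices `1 ≤ p < q ≤ m − 1` are
  adjacent (`q = p + 1`) as soon as vertex `0` is strictly positive (Cramer / convexity);
* **`locate_chord`** — two distinct unit points of the closed cone lying on the circle lie on a
  common side whose endpoints are on the circle, as nonnegative combinations of its endpoints.
-/

noncomputable section

namespace Summit.Ventures.Crystal3D

open Literature.Geometry.DiscreteGeometry Real InnerProductGeometry Finset
open scoped InnerProductSpace RealInnerProductSpace

/-! ## Locating two points of the cone on the circle -/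

section Locate

variable {m : ℕ} {v : ℕ → EuclideanSpace ℝ (Fin 3)} (hm : 3 ≤ m) (hper : ∀ i, v (i + m) = v i)
  (hcx : ∀ i j k, i < j → j < k → k < i + m → 0 < orient3 (v i) (v j) (v k))
include hm hper hcx

omit hm hper in
/-- **Two vertices on the circle are adjacent** (base vertex strictly positive, all signs
`≥ 0`): if `⟪v p, ν⟫ = ⟪v q, ν⟫ = 0` with `1 ≤ p < q ≤ m − 1` then `q = p + 1`. -/
theorem two_zeros_adjacent {ν : EuclideanSpace ℝ (Fin 3)} (h0 : 0 < ⟪v 0, ν⟫)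
    (hall : ∀ j, 0 ≤ ⟪v j, ν⟫) (hvm : v m = v 0) {p q : ℕ} (hp1 : 1 ≤ p) (hpq : p < q)
    (hqm : q ≤ m - 1) (hp : ⟪v p, ν⟫ = 0) (hq : ⟪v q, ν⟫ = 0) : q = p + 1 := by
  by_contra hne
  have hlt : p + 1 < q := by omega
  -- the two neighbours `p+1` and `q+1` are strictly positive
  have hZ : ∀ j, p < j → j < q → 0 < ⟪v j, ν⟫ := by
    intro j hj1 hj2
    rcases (hall j).lt_or_eq with h | h
    · exact h
    · exfalso
      have := eq_zero_of_three_on_circle hcx (i := p) (j := j) (l := q) hj1 hj2 (by omega) hp h.symm hq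
      rw [this, inner_zero_right] at h0; exact lt_irrefl _ h0
  have hp1pos := hZ (p + 1) (by omega) hlt
  have hq1pos : 0 < ⟪v (q + 1), ν⟫ := by
    rcases Nat.lt_or_ge (q + 1) m with h | h
    · rcases (hall (q + 1)).lt_or_eq with h' | h'
      · exact h'
      · exfalso
        have := eq_zero_of_three_on_circle hcx (i := p) (j := q) (l := q + 1) hpq (by omega) (by omega)
          hp hq h'.symm
        rw [this, inner_zero_right] at h0; exact lt_irrefl _ h0
    · rw [show q + 1 = m by omega, hvm]; exact h0
  -- Cramer in the basis `v p, v q, v (q+1)`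
  have hD := hcx p q (q + 1) hpq (by omega) (by omega)
  have hexp := orient3_expand (v p) (v q) (v (q + 1)) (v (p + 1))
  have h := congrArg (fun x => ⟪x, ν⟫) hexp
  simp only [inner_add_left, real_inner_smul_left, hp, hq, mul_zero, zero_add] at h
  -- `o(p,q,q+1) σ(p+1) = o(p,q,p+1) σ(q+1)` with `o(p,q,p+1) = −o(p,p+1,q) < 0`
  have hneg : orient3 (v p) (v q) (v (p + 1)) < 0 := by
    rw [orient3_swap_right]; linarith [hcx p (p + 1) q (by omega) hlt (by omega)]
  nlinarith [mul_pos hD hp1pos, mul_pos_of_neg_of_neg hneg (show -⟪v (q + 1), ν⟫ < 0 by linarith)]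

/-- **Locating two points of the cone on the circle.** If all vertices are on the closed positive
side of `ν ≠ 0`, two DISTINCT unit points `t, t'` of the closed cone lying on the circle `ν⊥`
lie on a common edge whose endpoints are on the circle, as nonnegative combinations. -/
theorem locate_chord {ν : EuclideanSpace ℝ (Fin 3)} (hν : ν ≠ 0) (hall : ∀ j, 0 ≤ ⟪v j, ν⟫)
    {t t' : EuclideanSpace ℝ (Fin 3)} (ht : ‖t‖ = 1) (ht' : ‖t'‖ = 1) (htt : t ≠ t')
    (htK : ∀ j, 0 ≤ orient3 (v j) (v (j + 1)) t) (ht'K : ∀ j, 0 ≤ orient3 (v j) (v (j + 1)) t')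
    (htν : ⟪t, ν⟫ = 0) (ht'ν : ⟪t', ν⟫ = 0) :
    ∃ e, ⟪v e, ν⟫ = 0 ∧ ⟪v (e + 1), ν⟫ = 0 ∧ ∃ α β α' β' : ℝ, 0 ≤ α ∧ 0 ≤ β ∧ 0 ≤ α' ∧ 0 ≤ β' ∧
      t = α • v e + β • v (e + 1) ∧ t' = α' • v e + β' • v (e + 1) := by
  classical
  -- a strictly positive vertex, rotated to index 0
  have hposv : ∃ r, r < m ∧ 0 < ⟪v r, ν⟫ := by
    by_contra h
    simp only [not_exists, not_and, not_lt] at h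
    have h0 : ⟪v 0, ν⟫ = 0 := le_antisymm (h 0 (by omega)) (hall 0)
    have h1 : ⟪v 1, ν⟫ = 0 := le_antisymm (h 1 (by omega)) (hall 1)
    have h2 : ⟪v 2, ν⟫ = 0 := le_antisymm (h 2 (by omega)) (hall 2)
    exact hν (eq_zero_of_three_on_circle hcx (i := 0) (j := 1) (l := 2) (by omega) (by omega)
      (by omega) h0 h1 h2)
  obtain ⟨r, hrm, hr⟩ := hposv
  obtain ⟨u, hu⟩ : ∃ u : ℕ → EuclideanSpace ℝ (Fin 3), ∀ i, u i = v (i + r) := ⟨_, fun _ => rfl⟩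
  have huper : ∀ i, u (i + m) = u i := fun i => by rw [hu, hu]; exact shift_periodic r hper i
  have hucx : ∀ i j k, i < j → j < k → k < i + m → 0 < orient3 (u i) (u j) (u k) :=
    fun i j k h1 h2 h3 => by rw [hu, hu, hu]; exact shift_convex r hcx i j k h1 h2 h3
  have hu0 : 0 < ⟪u 0, ν⟫ := by rw [hu, zero_add]; exact hr
  have hum : u m = u 0 := by rw [← huper 0, zero_add]
  have huall : ∀ j, 0 ≤ ⟪u j, ν⟫ := fun j => by rw [hu]; exact hall _
  have huedge : ∀ i, u (i + 1) = v (i + r + 1) := fun i => by rw [hu, show i + 1 + r = i + r + 1 by ring]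
  have hutK : ∀ i, i < m → 0 ≤ orient3 (u i) (u (i + 1)) t := fun i _ => by
    rw [huedge, hu]; exact htK _
  have hut'K : ∀ i, i < m → 0 ≤ orient3 (u i) (u (i + 1)) t' := fun i _ => by
    rw [huedge, hu]; exact ht'K _
  obtain ⟨i, hi1, hi2, b, c, hb, hc, hteq, hbz, hcz⟩ :=
    exists_edge_of_inner_zero hm hucx hum ν hutK (fun j _ => huall j) hu0 htν
  obtain ⟨i', hi'1, hi'2, b', c', hb', hc', ht'eq, hb'z, hc'z⟩ :=
    exists_edge_of_inner_zero hm hucx hum ν hut'K (fun j _ => huall j) hu0 ht'ν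
  -- no third vertex on the circle
  have hthird : ∀ p q l, 1 ≤ p → p < q → q < l → l ≤ m - 1 →
      ⟪u p, ν⟫ = 0 → ⟪u q, ν⟫ = 0 → ⟪u l, ν⟫ = 0 → False := by
    intro p q l h1 h2 h3 h4 hp hq hl
    exact hν (eq_zero_of_three_on_circle hucx h2 h3 (by omega) hp hq hl)
  -- helper: a unit vector is not `0`
  have ht0 : t ≠ 0 := by rw [← norm_ne_zero_iff, ht]; norm_num
  have ht'0 : t' ≠ 0 := by rw [← norm_ne_zero_iff, ht']; norm_num
  -- two parallel unit nonneg multiples of one vector are equal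
  have hsame : ∀ (x : EuclideanSpace ℝ (Fin 3)) (l1 l2 : ℝ), 0 ≤ l1 → 0 ≤ l2 → t = l1 • x →
      t' = l2 • x → False := by
    intro x l1 l2 hl1 hl2 h1 h2
    have hx : x ≠ 0 := by rintro rfl; rw [smul_zero] at h1; exact ht0 h1
    have he1 : l1 * ‖x‖ = 1 := by
      have := congrArg norm h1; rw [norm_smul, Real.norm_eq_abs, abs_of_nonneg hl1, ht] at this
      exact this.symm
    have he2 : l2 * ‖x‖ = 1 := by
      have := congrArg norm h2; rw [norm_smul, Real.norm_eq_abs, abs_of_nonneg hl2, ht'] at this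
      exact this.symm
    have h12 : l1 = l2 := by
      have hxn : 0 < ‖x‖ := norm_pos_iff.2 hx
      nlinarith
    exact htt (by rw [h1, h2, h12])
  -- every nonzero point of `K ∩ ν⊥` lies in the cone of a given ADJACENT pair of zero vertices
  have hpair : ∀ p, 1 ≤ p → p + 1 ≤ m - 1 → ⟪u p, ν⟫ = 0 → ⟪u (p + 1), ν⟫ = 0 →
      ∀ {y : EuclideanSpace ℝ (Fin 3)} {j : ℕ} {b c : ℝ}, y ≠ 0 → 1 ≤ j → j + 2 ≤ m → 0 ≤ b → 0 ≤ c →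
        y = b • u j + c • u (j + 1) → (b = 0 ∨ ⟪u j, ν⟫ = 0) → (c = 0 ∨ ⟪u (j + 1), ν⟫ = 0) →
        ∃ α β : ℝ, 0 ≤ α ∧ 0 ≤ β ∧ y = α • u p + β • u (p + 1) := by
    intro p hp1 hp2 hzp hzp1 y j b c hy0 hj1 hj2 hb hc hyeq hbz hcz
    -- a zero vertex other than `p, p+1` is impossible
    have hnoz : ∀ l, 1 ≤ l → l ≤ m - 1 → l ≠ p → l ≠ p + 1 → ⟪u l, ν⟫ ≠ 0 := by
      intro l hl1 hl2 hlp hlp1 hl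
      rcases Nat.lt_or_gt_of_ne hlp with h | h
      · exact hthird l p (p + 1) hl1 h (by omega) hp2 hl hzp hzp1
      · exact hthird p (p + 1) l hp1 (by omega) (by omega) hl2 hzp hzp1 hl
    by_cases hjp : j = p
    · subst hjp; exact ⟨b, c, hb, hc, hyeq⟩
    by_cases hjp1 : j = p + 1
    · -- `c` sits on `u (p+2)`, not a zero vertex
      have hc0 : c = 0 := by
        rcases hcz with h | h
        · exact h
        · exact absurd h (hnoz (j + 1) (by omega) (by omega) (by omega) (by omega))
      refine ⟨0, b, le_rfl, hb, ?_⟩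
      rw [hyeq, hc0, zero_smul, add_zero, zero_smul, zero_add, hjp1]
    by_cases hjp' : j + 1 = p
    · have hb0 : b = 0 := by
        rcases hbz with h | h
        · exact h
        · exact absurd h (hnoz j hj1 (by omega) hjp hjp1)
      refine ⟨c, 0, hc, le_rfl, ?_⟩
      rw [hyeq, hb0, zero_smul, zero_add, zero_smul, add_zero, hjp']
    · -- neither `j` nor `j+1` is a zero vertex: `y = 0`
      have hb0 : b = 0 := by
        rcases hbz with h | h
        · exact h
        · exact absurd h (hnoz j hj1 (by omega) hjp hjp1)
      have hc0 : c = 0 := by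
        rcases hcz with h | h
        · exact h
        · exact absurd h (hnoz (j + 1) (by omega) (by omega) hjp' (by omega))
      rw [hb0, hc0, zero_smul, zero_smul, add_zero] at hyeq
      exact absurd hyeq hy0
  have key : ∃ p, 1 ≤ p ∧ p + 1 ≤ m - 1 ∧ ⟪u p, ν⟫ = 0 ∧ ⟪u (p + 1), ν⟫ = 0 := by
    -- two distinct zero vertices exist, else `t = t'`
    by_cases hboth : ⟪u i, ν⟫ = 0 ∧ ⟪u (i + 1), ν⟫ = 0
    · exact ⟨i, hi1, by omega, hboth.1, hboth.2⟩
    by_cases hboth' : ⟪u i', ν⟫ = 0 ∧ ⟪u (i' + 1), ν⟫ = 0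
    · exact ⟨i', hi'1, by omega, hboth'.1, hboth'.2⟩
    -- `t` is a multiple of a single zero vertex `l`, `t'` of a single zero vertex `l'`
    have hl : ∃ l, (l = i ∨ l = i + 1) ∧ ⟪u l, ν⟫ = 0 ∧ ∃ d : ℝ, 0 ≤ d ∧ t = d • u l := by
      by_cases hb0 : b = 0
      · have hc0 : c ≠ 0 := by
          intro hc0; rw [hb0, hc0, zero_smul, zero_smul, add_zero] at hteq; exact ht0 hteq
        exact ⟨i + 1, Or.inr rfl, hcz.resolve_left hc0, c, hc, by rw [hteq, hb0, zero_smul, zero_add]⟩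
      · by_cases hc0 : c = 0
        · exact ⟨i, Or.inl rfl, hbz.resolve_left hb0, b, hb, by rw [hteq, hc0, zero_smul, add_zero]⟩
        · exact absurd ⟨hbz.resolve_left hb0, hcz.resolve_left hc0⟩ hboth
    have hl' : ∃ l', (l' = i' ∨ l' = i' + 1) ∧ ⟪u l', ν⟫ = 0 ∧ ∃ d : ℝ, 0 ≤ d ∧ t' = d • u l' := by
      by_cases hb0 : b' = 0
      · have hc0 : c' ≠ 0 := by
          intro hc0; rw [hb0, hc0, zero_smul, zero_smul, add_zero] at ht'eq; exact ht'0 ht'eq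
        exact ⟨i' + 1, Or.inr rfl, hc'z.resolve_left hc0, c', hc',
          by rw [ht'eq, hb0, zero_smul, zero_add]⟩
      · by_cases hc0 : c' = 0
        · exact ⟨i', Or.inl rfl, hb'z.resolve_left hb0, b', hb',
            by rw [ht'eq, hc0, zero_smul, add_zero]⟩
        · exact absurd ⟨hb'z.resolve_left hb0, hc'z.resolve_left hc0⟩ hboth'
    obtain ⟨l, hli, hlz, d, hd, htl⟩ := hl
    obtain ⟨l', hl'i, hl'z, d', hd', ht'l⟩ := hl'
    have hll : l ≠ l' := by
      intro h; rw [← h] at ht'l; exact hsame (u l) d d' hd hd' htl ht'l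
    have hl1 : 1 ≤ l := by rcases hli with h | h <;> omega
    have hlm : l ≤ m - 1 := by rcases hli with h | h <;> omega
    have hl'1 : 1 ≤ l' := by rcases hl'i with h | h <;> omega
    have hl'm : l' ≤ m - 1 := by rcases hl'i with h | h <;> omega
    rcases Nat.lt_or_gt_of_ne hll with h | h
    · have := two_zeros_adjacent hucx hu0 huall hum hl1 h hl'm hlz hl'z
      exact ⟨l, hl1, by omega, hlz, by rw [← this]; exact hl'z⟩
    · have := two_zeros_adjacent hucx hu0 huall hum hl'1 h hlm hl'z hlz
      exact ⟨l', hl'1, by omega, hl'z, by rw [← this]; exact hlz⟩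
  obtain ⟨p, hp1, hp2, hzp, hzp1⟩ := key
  obtain ⟨α, β, hα, hβ, hte⟩ := hpair p hp1 hp2 hzp hzp1 ht0 hi1 hi2 hb hc hteq hbz hcz
  obtain ⟨α', β', hα', hβ', ht'e⟩ := hpair p hp1 hp2 hzp hzp1 ht'0 hi'1 hi'2 hb' hc' ht'eq hb'z hc'z
  refine ⟨p + r, ?_, ?_, α, β, α', β', hα, hβ, hα', hβ', ?_, ?_⟩
  · rw [← hu]; exact hzp
  · rw [← huedge]; exact hzp1
  · rw [← hu, ← huedge]; exact hte
  · rw [← hu, ← huedge]; exact ht'e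

end Locate

end Summit.Ventures.Crystal3D

end
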